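import Literature.NumberTheory.Automorphic.RankinSelbergTorusIntegral
import HarnessLib

/-!
# The Euler factorisation of the unfolded Rankin–Selberg integral at a real point is EXACT

Topic `NumberTheory/Automorphic`; namespace `Literature.NumberTheory.Automorphic`. Proof file (theorems
only). `RankinSelbergTorusIntegral` proves the Euler LOWER BOUND
`T_v(q_v^{-σ}) · ∫_{B(insert v G) × K} ≤ ∫_{B(G) × K}` of the real-point method
(`schurSelfSum_mul_setLIntegral_le`): the translates `ϖ_v^μ B(insert v G)`, `μ ∈ ℕⁿ`, of the unit box
are disjoint subsets of `B(G)` on which the integrand is `|s_μ(x_v)|² q_v^{-σ|μ|}` times its value on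
`B(insert v G)`. This file proves the **equality**

  `T_v(q_v^{-σ}) · ∫_{B(insert v G) × K} = ∫_{B(G) × K}`

(`schurSelfSum_mul_setLIntegral_eq`), i.e. that the Rankin–Selberg integrand
`|W(diag(a) k)|² Φ(e_n diag(a) k) |det a|^σ δ_B(a)⁻¹` **vanishes on the rest of `B(G)`**
(`torusIntegrand_eq_zero_of_not_mem_iUnion`), under the two inputs which the printed proof uses
silently (Jacquet–Shalika (1981), §2, Prop. (2.3); Cogdell (2004), proof of Thm. 3.3: "`W(ϖ^J) = 0`
unless `J` is dominant, and `Φ_v(e_n ϖ^J k) = 0` unless `j_n ≥ 0`"):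

* `hWZ` — `‖W((z 1_n) g)‖ = ‖W(g)‖` for central `z 1_n`, `z ∈ 𝔸_Kˣ` (the central character; for the
  Whittaker coefficient of a smoothed cusp form this is `SmoothedFormCentralCharacter`), which reduces a
  torus point with negative `v`-valuations to one with exponents in `ℕⁿ`, where Shintani's formula with
  the vanishing off the antitone cone applies (`IsTorusUnramifiedAt`);
* `hΦv` — `Φ(y) = 0` unless the row `y` is integral at `v` (true for the standard test functions
  `Φ_∞ ⊗ 𝟙_{𝒪̂ⁿ}`, `standardTestFun_eq_zero_of_not_integral`), which with the **primitivity of the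
  rows of `GL_n(𝒪_v)`** (`exists_valued_lastRow_eq_one`: the last row of `k_v ∈ GL_n(𝒪_v)` has a unit
  entry, from `(k k⁻¹)_{nn} = 1` and the ultrametric inequality) forces the last exponent to be `≥ 0`.

Then the induction of `prod_schurSelfSum_mul_setLIntegral_le` becomes an equality
(`prod_schurSelfSum_mul_setLIntegral_eq`): for every finite set `F` of good places,
`(∏_{v ∈ F} T_v(q_v^{-σ})) · ∫_{B(Good) × K} = ∫_{B(Good ∖ F) × K}`, and for `F = Good` finite the right
side is the full torus integral `Ψ(σ) = rankinSelbergTorusIntegral νA νK W Φ σ`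
(`prod_schurSelfSum_mul_setLIntegral_eq_rankinSelbergTorusIntegral`) — the exact Euler factorisation
`Ψ = (∏_{v ∈ F} Ψ_v) · Ψ^F` over a finite set of unramified places (Jacquet–Shalika (1981), §4;
Cogdell (2004), Thm. 2.2 (Eulerian) with Thm. 3.3), at a real point, in `[0, ∞]`.

## References

* H. Jacquet, J. A. Shalika, *On Euler products and the classification of automorphic
  representations I*, Amer. J. Math. 103 (1981), §2 Prop. (2.3), §4 [JacquetShalikaAJM1981].
* J. W. Cogdell, *Analytic theory of L-functions for GL_n*, in *An Introduction to the Langlands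
  Program* (2004), §2.3 Thm. 2.2, §3 Thm. 3.3 [CogdellAnalyticTheory2004].
-/

noncomputable section

open MeasureTheory Measure NumberField IsDedekindDomain Matrix Set Filter Finset
open scoped MatrixGroups ENNReal NNReal ComplexConjugate Pointwise
open Literature.RingTheory.SymmetricFunctions.SymmPoly
open Literature.NumberTheory.GaloisRepresentations (ideleGroup localUnits)

namespace Literature.NumberTheory.Automorphic

/-! ### Primitivity of the rows of `GL_n(𝒪_v)` -/

section Primitive

variable {n : ℕ} {K : Type} [Field K] [NumberField K] {v : HeightOneSpectrum (𝓞 K)}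

/-- **The rows of a matrix in `GL_n(𝒪_v)` are primitive**: for `M ∈ GL_n(𝒪_v)` and every row index
`i`, some entry `M_{ij}` is a unit of `𝒪_v` (`1 = (M M⁻¹)_{ii} = Σ_j M_{ij} (M⁻¹)_{ji}` with integral
`(M⁻¹)_{ji}`; if every `|M_{ij}|_v < 1` the ultrametric inequality gives `|1|_v < 1`). [folklore] -/
theorem exists_valued_entry_eq_one_of_mem_glInt {M : GL (Fin n) (v.adicCompletion K)}
    (hM : M ∈ glInt n (v.adicCompletion K)) (i : Fin n) :
    ∃ j : Fin n, Valued.v ((M : Matrix (Fin n) (Fin n) (v.adicCompletion K)) i j) = 1 := by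
  obtain ⟨hint, hinv⟩ := (mem_glInt_iff M).1 hM
  by_contra h
  rw [not_exists] at h
  have hlt : ∀ j, Valued.v ((M : Matrix (Fin n) (Fin n) (v.adicCompletion K)) i j) < 1 := fun j =>
    lt_of_le_of_ne ((mem_integer_adicCompletion_iff K v).1 (hint i j)) (h j)
  have hone : ((M : Matrix (Fin n) (Fin n) (v.adicCompletion K)) *
      ((M⁻¹ : GL (Fin n) (v.adicCompletion K)) : Matrix (Fin n) (Fin n) (v.adicCompletion K))) i i = 1 := by
    rw [← Matrix.GeneralLinearGroup.coe_mul, mul_inv_cancel, Matrix.GeneralLinearGroup.coe_one, Matrix.one_apply_eq]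
  have hsum : Valued.v (∑ j, (M : Matrix (Fin n) (Fin n) (v.adicCompletion K)) i j *
      ((M⁻¹ : GL (Fin n) (v.adicCompletion K)) : Matrix (Fin n) (Fin n) (v.adicCompletion K)) j i) < 1 := by
    refine Valuation.map_sum_lt _ one_ne_zero fun j _ => ?_
    rw [Valuation.map_mul]
    calc Valued.v ((M : Matrix (Fin n) (Fin n) (v.adicCompletion K)) i j) *
          Valued.v (((M⁻¹ : GL (Fin n) (v.adicCompletion K)) : Matrix (Fin n) (Fin n) (v.adicCompletion K)) j i)
        ≤ Valued.v ((M : Matrix (Fin n) (Fin n) (v.adicCompletion K)) i j) * 1 :=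
          mul_le_mul_right ((mem_integer_adicCompletion_iff K v).1 (hinv j i)) _
      _ < 1 := by rw [mul_one]; exact hlt j
  rw [← Matrix.mul_apply, hone, map_one] at hsum
  exact lt_irrefl _ hsum

/-- **The last row of `diag(a) k` at a good place**: for `k ∈ K` (so `k_v ∈ GL_n(𝒪_v)`) and `0 < n`,
some entry of the last row `e_n k` has `v`-valuation `1`. [folklore] -/
theorem exists_valued_lastRow_eq_one (hn : 0 < n) (k : ↥(maximalCompactAdelic n K)) :
    ∃ j : Fin n, Valued.v ((lastRow n K (show GL (Fin n) (AdeleRing (𝓞 K) K) from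
      (k : (AdelicGroupData.gl n K).Adelic)) j).2 v) = 1 := by
  set g : GL (Fin n) (AdeleRing (𝓞 K) K) := (show GL (Fin n) (AdeleRing (𝓞 K) K) from
    (k : (AdelicGroupData.gl n K).Adelic)) with hg
  have hM : localComponent v g ∈ glInt n (v.adicCompletion K) :=
    localComponent_mem_glInt_of_mem_maximalCompactAdelic k.2
  obtain ⟨j, hj⟩ := exists_valued_entry_eq_one_of_mem_glInt hM ⟨n - 1, Nat.sub_lt hn one_pos⟩
  refine ⟨j, ?_⟩
  -- the last row of `g` is `g_{n-1, ·}`, and its `v`-component is the entry of the local component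
  have hrow : (lastRow n K g j).2 v =
      ((localComponent v g : GL (Fin n) (v.adicCompletion K)) : Matrix (Fin n) (Fin n) (v.adicCompletion K))
        ⟨n - 1, Nat.sub_lt hn one_pos⟩ j := by
    rw [lastRow, Matrix.vecMul, dotProduct]
    rw [Finset.sum_eq_single (⟨n - 1, Nat.sub_lt hn one_pos⟩ : Fin n)]
    · simp only [lastBasisVec]
      rw [if_pos (by omega), one_mul]
      rfl
    · intro i _ hi
      simp only [lastBasisVec]
      rw [if_neg, zero_mul]
      intro h
      apply hi
      exact Fin.ext (show (i : ℕ) = n - 1 by omega)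
    · intro h; exact absurd (Finset.mem_univ _) h
  rw [hrow]
  exact hj

end Primitive

/-! ### The integrand vanishes off the translates of the unit box -/

section Support

variable {n : ℕ} {K : Type} [Field K] [NumberField K] {v : HeightOneSpectrum (𝓞 K)}
  {ϖ : (v.adicCompletion K)ˣ} {x : Fin n → ℂ}
  {W : GL (Fin n) (AdeleRing (𝓞 K) K) → ℂ} {Φ : (Fin n → AdeleRing (𝓞 K) K) → ℝ}

/-- The `v`-component of an idele has non-zero valuation. [folklore] -/
theorem valued_snd_idele_ne_zero (z : ideleGroup K) :
    Valued.v (((z : ideleGroup K) : AdeleRing (𝓞 K) K).2 v) ≠ 0 := by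
  rw [Valuation.ne_zero_iff, ← AdelicGroupData.adeleEval_apply]
  exact (Units.map (AdelicGroupData.adeleEval K v : AdeleRing (𝓞 K) K →+* v.adicCompletion K).toMonoidHom
    z).ne_zero

/-- **Membership in a translate of the unit box from the `v`-valuations.** If `a` lies in the unit box
off `G ∌ v` and its entries have `v`-valuations `exp(-μ_i)`, `μ ∈ ℕⁿ`, then `a ∈ ϖ_v^μ · B(insert v G)`
(`a = ϖ^μ · (ϖ^{-μ} a)` with `ϖ^{-μ} a` a unit at `v` and unchanged elsewhere). [folklore] -/
theorem mem_smul_unitBox_of_valued_eq (hϖ : Valued.v (ϖ : v.adicCompletion K) = WithZero.exp (-1 : ℤ))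
    {G : Set (HeightOneSpectrum (𝓞 K))} (hv : v ∉ G) {a : Fin n → ideleGroup K}
    (ha : a ∈ unitBox (n := n) (K := K) G) {mu : Fin n → ℕ}
    (hval : ∀ i, Valued.v (((a i : ideleGroup K) : AdeleRing (𝓞 K) K).2 v) = WithZero.exp (-(mu i : ℤ))) :
    a ∈ localTorusPow ϖ mu • unitBox (n := n) (K := K) (insert v G) := by
  refine Set.mem_smul_set.2 ⟨(localTorusPow ϖ mu)⁻¹ * a, ?_, by rw [smul_eq_mul, mul_inv_cancel_left]⟩
  intro w hw i
  -- valuation of the `w`-component of `(ϖ^μ)⁻¹ a`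
  have hcomp : Valued.v (((((localTorusPow ϖ mu)⁻¹ * a) i : ideleGroup K) : AdeleRing (𝓞 K) K).2 w) =
      Valued.v ((((localTorusPow ϖ mu i)⁻¹ : ideleGroup K) : AdeleRing (𝓞 K) K).2 w) *
        Valued.v (((a i : ideleGroup K) : AdeleRing (𝓞 K) K).2 w) := by
    rw [Pi.mul_apply, Pi.inv_apply, Units.val_mul, ← AdelicGroupData.adeleEval_apply, map_mul, map_mul,
      AdelicGroupData.adeleEval_apply, AdelicGroupData.adeleEval_apply]
  -- the inverse has the inverse valuation
  have hinv : Valued.v ((((localTorusPow ϖ mu i)⁻¹ : ideleGroup K) : AdeleRing (𝓞 K) K).2 w) *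
      Valued.v ((((localTorusPow ϖ mu i) : ideleGroup K) : AdeleRing (𝓞 K) K).2 w) = 1 := by
    rw [← AdelicGroupData.adeleEval_apply, ← AdelicGroupData.adeleEval_apply, ← map_mul, ← map_mul,
      ← Units.val_mul, inv_mul_cancel, Units.val_one, map_one, map_one]
  rw [hcomp]
  rcases Set.mem_insert_iff.1 hw with rfl | hwG
  · have ht : Valued.v ((((localTorusPow ϖ mu i) : ideleGroup K) : AdeleRing (𝓞 K) K).2 w) =
        WithZero.exp (-(mu i : ℤ)) := by
      rw [localTorusPow_snd_apply_self, Units.val_pow_eq_pow_val, map_pow, hϖ, ← WithZero.exp_nsmul]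
      simp
    rw [ht] at hinv
    rw [eq_inv_of_mul_eq_one_left hinv, hval i, ← WithZero.exp_neg, ← WithZero.exp_add, neg_neg,
      add_neg_cancel, WithZero.exp_zero]
  · have hwv : w ≠ v := fun h => hv (h ▸ hwG)
    have ht : Valued.v ((((localTorusPow ϖ mu i) : ideleGroup K) : AdeleRing (𝓞 K) K).2 w) = 1 := by
      rw [localTorusPow_snd_apply_of_ne ϖ mu i hwv, map_one]
    rw [ht, mul_one] at hinv
    rw [hinv, one_mul]
    exact ha w hwG i

/-- Constant diagonal tuples are scalar matrices. [folklore] -/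
theorem glDiagonal_const (z : ideleGroup K) :
    glDiagonal n (AdeleRing (𝓞 K) K) (fun _ : Fin n => z) = Matrix.GeneralLinearGroup.scalar (Fin n) z :=
  Matrix.GeneralLinearGroup.ext fun i j => by
    rw [coe_glDiagonal, Matrix.GeneralLinearGroup.coe_scalar, Matrix.scalar_apply]

/-- **The Rankin–Selberg integrand vanishes on the unit box off the translates `ϖ_v^μ B`, `μ ∈ ℕⁿ`.**
For `W` an unramified Whittaker–Hecke datum at `v ∉ G` with `‖W‖` invariant under the centre, `Φ`
supported on rows integral at `v`, `a ∈ B(G)` and `k ∈ K`: if `a ∉ ⋃_μ ϖ_v^μ B(insert v G)` then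
`|W(diag(a) k)|² Φ(e_n diag(a) k) |det a|^σ δ_B(a)⁻¹ = 0`. Writing the `v`-exponents of `a` as
`e ∈ ℤⁿ` and shifting by the central `ϖ_v^m 1_n`, `m ≫ 0`, Shintani's formula shows `W(diag(a) k) = 0`
unless `e + m` — equivalently `e` — is antitone; `Φ ≠ 0` forces the last row `a_n e_n k` to be
`v`-integral, and the primitivity of `e_n k_v` gives `e_n ≥ 0`; hence `e ∈ ℕⁿ` and
`a ∈ ϖ_v^e B(insert v G)` (Jacquet–Shalika (1981), §2; Cogdell (2004), proof of Thm. 3.3). [folklore] -/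
theorem torusIntegrand_eq_zero_of_not_mem_iUnion (hn : 0 < n) (hW : IsTorusUnramifiedAt n K W v ϖ x)
    (hWZ : ∀ (z : ideleGroup K) (g : GL (Fin n) (AdeleRing (𝓞 K) K)),
      ‖W (Matrix.GeneralLinearGroup.scalar (Fin n) z * g)‖ = ‖W g‖)
    (hΦv : ∀ y : Fin n → AdeleRing (𝓞 K) K, Φ y ≠ 0 → ∀ j, Valued.v ((y j).2 v) ≤ 1)
    (σ : ℝ) {G : Set (HeightOneSpectrum (𝓞 K))} (hv : v ∉ G) {a : Fin n → ideleGroup K}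
    (ha : a ∈ unitBox (n := n) (K := K) G) (k : ↥(maximalCompactAdelic n K))
    (hnot : a ∉ ⋃ mu : Fin n → ℕ, localTorusPow ϖ mu • unitBox (n := n) (K := K) (insert v G)) :
    torusIntegrand n K W Φ σ (a, k) = 0 := by
  -- the `v`-adic exponents of the entries of `a`
  set e : Fin n → ℤ := fun i => -WithZero.log (Valued.v (((a i : ideleGroup K) : AdeleRing (𝓞 K) K).2 v))
    with he
  have hev : ∀ i, Valued.v (((a i : ideleGroup K) : AdeleRing (𝓞 K) K).2 v) = WithZero.exp (-(e i)) := by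
    intro i
    simp only [he, neg_neg]
    rw [WithZero.exp_log (valued_snd_idele_ne_zero (a i))]
  by_cases hW0 : W (torusPoint n K (a, k)) = 0
  · have h0 : ‖W (torusPoint n K (a, k))‖ ^ 2 * Φ (lastRow n K (torusPoint n K (a, k))) *
        torusWeight n K σ a = 0 := by rw [hW0, norm_zero]; ring
    rw [torusIntegrand, h0, ENNReal.ofReal_zero]
  by_cases hΦ0 : Φ (lastRow n K (torusPoint n K (a, k))) = 0
  · have h0 : ‖W (torusPoint n K (a, k))‖ ^ 2 * Φ (lastRow n K (torusPoint n K (a, k))) *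
        torusWeight n K σ a = 0 := by rw [hΦ0]; ring
    rw [torusIntegrand, h0, ENNReal.ofReal_zero]
  exfalso
  -- Step 1: a non-negative shift of the exponents
  obtain ⟨m, hm⟩ : ∃ m : ℕ, ∀ i, 0 ≤ e i + m := by
    refine ⟨∑ i, (e i).natAbs, fun i => ?_⟩
    have h1 : (e i).natAbs ≤ ∑ j, (e j).natAbs :=
      Finset.single_le_sum (f := fun j => (e j).natAbs) (fun j _ => Nat.zero_le _) (Finset.mem_univ i)
    omega
  set mu' : Fin n → ℕ := fun i => (e i + m).toNat with hmu'
  have hmu'i : ∀ i, ((mu' i : ℕ) : ℤ) = e i + m := fun i => Int.toNat_of_nonneg (hm i)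
  -- the central idele `ζ = ϖ^m` at `v`, and `a' = ζ a`
  set ζ : ideleGroup K := localUnits v (ϖ ^ m) with hζ
  set a' : Fin n → ideleGroup K := (fun _ => ζ) * a with ha'
  have hζv : Valued.v ((ζ : AdeleRing (𝓞 K) K).2 v) = WithZero.exp (-(m : ℤ)) := by
    rw [hζ, GaloisRepresentations.localUnits_snd_apply_self, Units.val_pow_eq_pow_val, map_pow, hW.valued_eq,
      ← WithZero.exp_nsmul]
    simp
  have hζw : ∀ w, w ≠ v → (ζ : AdeleRing (𝓞 K) K).2 w = 1 := fun w hw =>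
    localTorusPow_snd_apply_of_ne ϖ (fun _ : Fin n => m) ⟨0, hn⟩ hw
  have ha'v : ∀ i, Valued.v (((a' i : ideleGroup K) : AdeleRing (𝓞 K) K).2 v) = WithZero.exp (-(mu' i : ℤ)) := by
    intro i
    rw [ha', Pi.mul_apply, Units.val_mul, ← AdelicGroupData.adeleEval_apply, map_mul, Valuation.map_mul,
      AdelicGroupData.adeleEval_apply, AdelicGroupData.adeleEval_apply, hζv, hev i, hmu'i, ← WithZero.exp_add]
    congr 1
    ring
  have ha'G : a' ∈ unitBox (n := n) (K := K) G := by
    intro w hw i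
    have hwv : w ≠ v := fun h => hv (h ▸ hw)
    change Valued.v (((a' i : ideleGroup K) : AdeleRing (𝓞 K) K).2 w) = 1
    rw [ha', Pi.mul_apply, Units.val_mul, ← AdelicGroupData.adeleEval_apply, map_mul,
      AdelicGroupData.adeleEval_apply, AdelicGroupData.adeleEval_apply, hζw w hwv, one_mul]
    exact ha w hw i
  -- `a' = ϖ^{μ'} a₀` with `a₀` a unit at `v`
  obtain ⟨a₀, ha₀, ha₀eq⟩ := Set.mem_smul_set.1 (mem_smul_unitBox_of_valued_eq hW.valued_eq hv ha'G ha'v)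
  have ha₀v : ∀ i, Valued.v (((a₀ i : ideleGroup K) : AdeleRing (𝓞 K) K).2 v) = 1 := fun i =>
    ha₀ v (Set.mem_insert v G) i
  -- the torus points
  have htp1 : Matrix.GeneralLinearGroup.scalar (Fin n) ζ * torusPoint n K (a, k) = torusPoint n K (a', k) := by
    rw [← glDiagonal_const, ← torusPoint_mul]
  have htp2 : torusPoint n K (a', k) = GLn.ofLocal n K v (piPowGL ϖ.ne_zero mu') * torusPoint n K (a₀, k) := by
    rw [← ha₀eq, smul_eq_mul, torusPoint_mul, glDiagonal_localTorusPow]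
  -- Shintani at `a₀`
  have hShin := hW.apply_ofLocal_piPowGL_mul (localComponent_torusPoint_mem_glInt ha₀v k) mu'
  have hnormW : ‖W (torusPoint n K (a, k))‖ =
      ‖(((Real.sqrt (v.residueCard : ℝ) : ℝ) : ℂ)) ^ (-torusExponent mu') * schurTrunc x mu' *
        W (torusPoint n K (a₀, k))‖ := by
    rw [← hWZ ζ, htp1, htp2, hShin]
  -- Step 2: `μ'` is antitone
  have hanti : Antitone mu' := by
    by_contra hna
    apply hW0
    rw [← norm_eq_zero, hnormW, schurTrunc_of_not_antitone x hna, mul_zero, zero_mul, norm_zero]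
  -- Step 3: the last exponent is `≥ 0`
  set il : Fin n := ⟨n - 1, Nat.sub_lt hn one_pos⟩ with hil
  have helast : 0 ≤ e il := by
    obtain ⟨j, hj⟩ := exists_valued_lastRow_eq_one (K := K) (v := v) hn k
    have hrow := hΦv _ hΦ0 j
    have hlr : lastRow n K (torusPoint n K (a, k)) =
        ((lastEntry a : ideleGroup K) : AdeleRing (𝓞 K) K) •
          lastRow n K (show GL (Fin n) (AdeleRing (𝓞 K) K) from (k : (AdelicGroupData.gl n K).Adelic)) :=
      lastRow_glDiagonal_mul a _
    rw [hlr, Pi.smul_apply, smul_eq_mul, ← AdelicGroupData.adeleEval_apply, map_mul, Valuation.map_mul,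
      AdelicGroupData.adeleEval_apply, AdelicGroupData.adeleEval_apply, hj, mul_one, lastEntry, dif_pos hn,
      hev, ← WithZero.exp_zero, WithZero.exp_le_exp] at hrow
    exact neg_nonpos.1 hrow
  -- Step 4: all exponents are `≥ 0`
  have heall : ∀ i, 0 ≤ e i := by
    intro i
    have hle : i ≤ il := Fin.le_iff_val_le_val.2 (Nat.le_sub_one_of_lt i.2)
    have h := hanti hle
    have h' : ((mu' il : ℕ) : ℤ) ≤ mu' i := by exact_mod_cast h
    rw [hmu'i, hmu'i] at h'
    omega
  -- Step 5: `a ∈ ϖ^e B(insert v G)`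
  have hmu : ∀ i, (((fun i => (e i).toNat : Fin n → ℕ) i : ℕ) : ℤ) = e i := fun i =>
    Int.toNat_of_nonneg (heall i)
  exact hnot (Set.mem_iUnion.2 ⟨fun i => (e i).toNat,
    mem_smul_unitBox_of_valued_eq hW.valued_eq hv ha fun i => by rw [hev i, hmu i]⟩)

/-- **The standard test functions are supported on integral rows**: `Φ_∞ ⊗ 𝟙_{𝒪̂ⁿ} (y) ≠ 0` forces
`|y_j|_v ≤ 1` for every finite place `v` and every `j`. [folklore] -/
theorem standardTestFun_ne_zero_valued_le_one (Φinf : (Fin n → InfiniteAdeleRing K) → ℝ)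
    {y : Fin n → AdeleRing (𝓞 K) K} (hy : standardTestFun n K Φinf y ≠ 0) (j : Fin n) :
    Valued.v ((y j).2 v) ≤ 1 := by
  classical
  unfold standardTestFun at hy
  split_ifs at hy with h
  · exact (HeightOneSpectrum.mem_adicCompletionIntegers _ _ _).1 (h j v)
  · exact absurd rfl hy

end Support

/-! ### The exact Euler factorisation at a real point -/

section Exact

variable {n : ℕ} {K : Type} [Field K] [NumberField K]
variable [MeasurableSpace (ideleGroup K)] [BorelSpace (ideleGroup K)]

-- the house local instances of `RankinSelbergTorusIntegral` (Borel structure of `GL_n(𝔸_K)`, second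
-- countability of `𝔸_Kˣ` for the Borel structure of the finite product `(𝔸_Kˣ)ⁿ`); none overrides a
-- Mathlib instance
attribute [local instance] adelicBorel borelSpace_adelic locallyCompactSpace_adelic
  secondCountableTopology_gl_adelic secondCountableTopology_ideleGroup

variable (νA : Measure (Fin n → ideleGroup K)) [νA.IsMulLeftInvariant] [SFinite νA]
  (νK : Measure ↥(maximalCompactAdelic n K)) [SFinite νK]

variable {v : HeightOneSpectrum (𝓞 K)} {ϖ : (v.adicCompletion K)ˣ} {x : Fin n → ℂ}
  {W : GL (Fin n) (AdeleRing (𝓞 K) K) → ℂ} {Φ : (Fin n → AdeleRing (𝓞 K) K) → ℝ}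

/-- **One exact Euler factor.** For `v ∉ G`, `W` an unramified Whittaker–Hecke datum at `v` with `‖W‖`
invariant under the centre, `Φ` spherical at `v` and supported on `v`-integral rows:
`T_v(q_v^{-σ}) · ∫_{B(insert v G) × K} = ∫_{B(G) × K}` — the equality case of
`schurSelfSum_mul_setLIntegral_le`, the integrand vanishing on `B(G) ∖ ⋃_μ ϖ_v^μ B(insert v G)`
(`torusIntegrand_eq_zero_of_not_mem_iUnion`). (Jacquet–Shalika (1981), §2 Prop. (2.3), §4;
Cogdell (2004), Thm. 3.3.) [cite: JacquetShalikaAJM1981, §2 Prop. (2.3), §4] -/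
theorem schurSelfSum_mul_setLIntegral_eq (hn : 0 < n) (hW : IsTorusUnramifiedAt n K W v ϖ x)
    (hWZ : ∀ (z : ideleGroup K) (g : GL (Fin n) (AdeleRing (𝓞 K) K)),
      ‖W (Matrix.GeneralLinearGroup.scalar (Fin n) z * g)‖ = ‖W g‖)
    (hΦ : IsLastRowSphericalAt n K Φ v)
    (hΦv : ∀ y : Fin n → AdeleRing (𝓞 K) K, Φ y ≠ 0 → ∀ j, Valued.v ((y j).2 v) ≤ 1)
    (σ : ℝ) {G : Set (HeightOneSpectrum (𝓞 K))} (hv : v ∉ G) :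
    schurSelfSum x ((v.residueCard : ℝ) ^ (-σ)) *
        ∫⁻ p in unitBox (insert v G) ×ˢ Set.univ, torusIntegrand n K W Φ σ p ∂(νA.prod νK) =
      ∫⁻ p in unitBox G ×ˢ Set.univ, torusIntegrand n K W Φ σ p ∂(νA.prod νK) := by
  rw [← tsum_localCoeff v x σ, ← ENNReal.tsum_mul_right]
  simp_rw [← setLIntegral_smul_unitBox_eq νA νK hW hΦ σ G]
  have hUm : ∀ mu : Fin n → ℕ, MeasurableSet ((localTorusPow ϖ mu • unitBox (n := n) (K := K) (insert v G)) ×ˢ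
      (Set.univ : Set ↥(maximalCompactAdelic n K))) := fun mu =>
    (measurableSet_smul_unitBox _ _).prod MeasurableSet.univ
  rw [← lintegral_iUnion hUm (fun mu mu' hne => Set.disjoint_prod.2 (Or.inl
      (pairwise_disjoint_localTorusPow_smul_unitBox hW.valued_eq G hne)))]
  set U := ⋃ mu : Fin n → ℕ, (localTorusPow ϖ mu • unitBox (n := n) (K := K) (insert v G)) ×ˢ
    (Set.univ : Set ↥(maximalCompactAdelic n K)) with hU
  set S := unitBox (n := n) (K := K) G ×ˢ (Set.univ : Set ↥(maximalCompactAdelic n K)) with hS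
  have hUM : MeasurableSet U := MeasurableSet.iUnion hUm
  have hSM : MeasurableSet S := (measurableSet_unitBox _).prod MeasurableSet.univ
  have hsub : U ⊆ S := Set.iUnion_subset fun mu =>
    Set.prod_mono (localTorusPow_smul_unitBox_subset hv mu) subset_rfl
  -- the integrand vanishes on `S ∖ U`
  have hzero : ∫⁻ p in S \ U, torusIntegrand n K W Φ σ p ∂(νA.prod νK) = 0 := by
    rw [setLIntegral_congr_fun (hSM.diff hUM) (g := fun _ => 0) ?_, lintegral_zero]
    rintro ⟨a, k⟩ ⟨⟨haB, -⟩, hpU⟩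
    refine torusIntegrand_eq_zero_of_not_mem_iUnion hn hW hWZ hΦv σ hv haB k fun hmem => hpU ?_
    obtain ⟨mu, hmu⟩ := Set.mem_iUnion.1 hmem
    exact Set.mem_iUnion.2 ⟨mu, Set.mk_mem_prod hmu (Set.mem_univ _)⟩
  symm
  calc ∫⁻ p in S, torusIntegrand n K W Φ σ p ∂(νA.prod νK)
      = ∫⁻ p in U ∪ S \ U, torusIntegrand n K W Φ σ p ∂(νA.prod νK) := by rw [Set.union_sdiff_cancel hsub]
    _ = ∫⁻ p in U, torusIntegrand n K W Φ σ p ∂(νA.prod νK) +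
          ∫⁻ p in S \ U, torusIntegrand n K W Φ σ p ∂(νA.prod νK) :=
        lintegral_union (hSM.diff hUM) Set.disjoint_sdiff_right
    _ = ∫⁻ p in U, torusIntegrand n K W Φ σ p ∂(νA.prod νK) := by rw [hzero, add_zero]

variable {ϖ : ∀ v : HeightOneSpectrum (𝓞 K), (v.adicCompletion K)ˣ}
  {x : HeightOneSpectrum (𝓞 K) → Fin n → ℂ}

/-- **The exact Euler factorisation on the unit boxes.** If `W` is an unramified Whittaker–Hecke datum,
with `‖W‖` invariant under the centre, and `Φ` is spherical and integrally supported at every place of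
`Good`, then for every finite `F ⊆ Good`:
`(∏_{v ∈ F} T_v(q_v^{-σ})) · ∫_{B(Good) × K} = ∫_{B(Good ∖ F) × K}` (induction on `F`, one exact
Euler factor at a time). [cite: JacquetShalikaAJM1981, §2 Prop. (2.3), §4] -/
theorem prod_schurSelfSum_mul_setLIntegral_eq (hn : 0 < n) {Good : Set (HeightOneSpectrum (𝓞 K))}
    (hW : ∀ v ∈ Good, IsTorusUnramifiedAt n K W v (ϖ v) (x v))
    (hWZ : ∀ (z : ideleGroup K) (g : GL (Fin n) (AdeleRing (𝓞 K) K)),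
      ‖W (Matrix.GeneralLinearGroup.scalar (Fin n) z * g)‖ = ‖W g‖)
    (hΦ : ∀ v ∈ Good, IsLastRowSphericalAt n K Φ v)
    (hΦv : ∀ v ∈ Good, ∀ y : Fin n → AdeleRing (𝓞 K) K, Φ y ≠ 0 → ∀ j, Valued.v ((y j).2 v) ≤ 1)
    (σ : ℝ) (F : Finset (HeightOneSpectrum (𝓞 K))) (hF : (↑F : Set (HeightOneSpectrum (𝓞 K))) ⊆ Good) :
    (∏ v ∈ F, schurSelfSum (x v) ((v.residueCard : ℝ) ^ (-σ))) *
        ∫⁻ p in unitBox Good ×ˢ Set.univ, torusIntegrand n K W Φ σ p ∂(νA.prod νK) =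
      ∫⁻ p in unitBox (Good \ ↑F) ×ˢ Set.univ, torusIntegrand n K W Φ σ p ∂(νA.prod νK) := by
  classical
  induction F using Finset.induction_on with
  | empty => simp
  | insert v F hvF ih =>
    have hv : v ∈ Good := hF (Finset.mem_coe.2 (Finset.mem_insert_self v F))
    have hF' : (↑F : Set (HeightOneSpectrum (𝓞 K))) ⊆ Good := fun w hw =>
      hF (Finset.mem_coe.2 (Finset.mem_insert_of_mem (Finset.mem_coe.1 hw)))
    rw [Finset.prod_insert hvF, mul_assoc, ih hF']
    have hset : Good \ ↑F = insert v (Good \ ↑(insert v F)) := by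
      ext w
      by_cases hw : w = v
      · subst hw
        simp [hv, hvF]
      · simp [hw]
    rw [hset]
    exact schurSelfSum_mul_setLIntegral_eq νA νK hn (hW v hv) hWZ (hΦ v hv) (hΦv v hv) σ (by simp)

omit [MeasurableSpace (ideleGroup K)] [BorelSpace (ideleGroup K)] in
/-- The unit box off the empty set of places is everything. [folklore] -/
theorem unitBox_empty : unitBox (n := n) (K := K) (∅ : Set (HeightOneSpectrum (𝓞 K))) = Set.univ :=
  Set.eq_univ_of_forall fun _ w hw => absurd hw (Set.notMem_empty w)

/-- **The exact Euler factorisation of the unfolded Rankin–Selberg integral at a real point over a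
finite set of unramified places**: for a finite set `F` of places at which `W` is an unramified
Whittaker–Hecke datum (with `‖W‖` central-invariant) and `Φ` is spherical and integrally supported,
`(∏_{v ∈ F} T_v(q_v^{-σ})) · ∫_{B(F) × K} |W(diag(a) k)|² Φ(e_n diag(a) k) |det a|^σ δ_B(a)⁻¹ = Ψ(σ)`,
the full torus integral `rankinSelbergTorusIntegral νA νK W Φ σ` — `Ψ = (∏_{v ∈ F} Ψ_v) · Ψ^F` with
`Ψ_v = T_v(q_v^{-σ})` (Jacquet–Shalika (1981), §2 Prop. (2.3) and §4; Cogdell (2004), Thm. 2.2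
(Eulerian) with Thm. 3.3), at a real point, in `[0, ∞]`, with no convergence hypothesis.
[cite: JacquetShalikaAJM1981, §2 Prop. (2.3), §4] [cite: CogdellAnalyticTheory2004, Thm. 2.2, Thm. 3.3] -/
theorem prod_schurSelfSum_mul_setLIntegral_eq_rankinSelbergTorusIntegral (hn : 0 < n)
    (F : Finset (HeightOneSpectrum (𝓞 K)))
    (hW : ∀ v ∈ F, IsTorusUnramifiedAt n K W v (ϖ v) (x v))
    (hWZ : ∀ (z : ideleGroup K) (g : GL (Fin n) (AdeleRing (𝓞 K) K)),
      ‖W (Matrix.GeneralLinearGroup.scalar (Fin n) z * g)‖ = ‖W g‖)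
    (hΦ : ∀ v ∈ F, IsLastRowSphericalAt n K Φ v)
    (hΦv : ∀ v ∈ F, ∀ y : Fin n → AdeleRing (𝓞 K) K, Φ y ≠ 0 → ∀ j, Valued.v ((y j).2 v) ≤ 1) (σ : ℝ) :
    (∏ v ∈ F, schurSelfSum (x v) ((v.residueCard : ℝ) ^ (-σ))) *
        ∫⁻ p in unitBox (↑F : Set (HeightOneSpectrum (𝓞 K))) ×ˢ Set.univ, torusIntegrand n K W Φ σ p
          ∂(νA.prod νK) =
      rankinSelbergTorusIntegral n K νA νK W Φ σ := by
  rw [prod_schurSelfSum_mul_setLIntegral_eq νA νK hn (Good := ↑F) (fun v hv => hW v (Finset.mem_coe.1 hv)) hWZ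
    (fun v hv => hΦ v (Finset.mem_coe.1 hv)) (fun v hv => hΦv v (Finset.mem_coe.1 hv)) σ F subset_rfl,
    Set.sdiff_self, unitBox_empty, Set.univ_prod_univ, Measure.restrict_univ]
  rfl

end Exact

end Literature.NumberTheory.Automorphic
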